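import Literature.NumberTheory.GelbartRogawski1991.ThetaDichotomyVocabulary                -- ★ `kernelLineCM`
import Literature.NumberTheory.Automorphic.UnitaryGroupSymplecticEmbedding               -- ★ `hermForm`
import Literature.NumberTheory.Automorphic.UnitaryGroupNonsplitPlace                    -- ★ `LocalRing.eq_iff_apply_eq`
import Literature.NumberTheory.Automorphic.QuadraticLocalBaseChange                     -- ★ `conjLocal_algebraMap`
import HarnessLib

/-!
# Crux `H413`, programme P2, N3 road (a)-block, (C5c) input (KL) — THE KERNEL LINE IS THE FRAME LINE TIMES A LOCAL NORM

Cell hodgecm-mathlib (D-0151), FLOOR 0, crux item H413 = stmt-HodgeConjecture-24833, programme P2; N3 road v3, (a)-block, lead B-p18 (g29).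
THEOREMS ONLY (no `def`, no instance, no notation, no named fact, no `sorry`); never imports a `Cruxes/…/Lines` module; kernel lane
`--supports stmt-HodgeConjecture-24833 --as helper`.  HC_CM is proved only modulo the printed citations until rung 0 closes; nothing printed is asserted here.

WHAT.  At a finite place `v` of `L⁺` NON-SPLIT in the CM field `L` (`S = L ⊗ L⁺_v` is the field `L_w`), let `dV′ = (t, a₁, a₂)` be a real non-zero
diagonal whose plane `diag(a₁, a₂) ⊗ 1` carries an isotropic vector `x ≠ 0`: `σ(x₀)·a₁·x₀ + σ(x₁)·a₂·x₁ = 0`.  Then both coordinates of `x` are non-zero and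
`−a₁a₂ = N(a₂x₁ ∕ x₀)`, `N(z) = z·σ(z)`; equivalently, for the Witt kernel line ★ `kernelLineCM dV′ = ⟨−t a₁ a₂⟩` of `V = diag(dV′)`:
`ι(t) = ι(−t a₁ a₂) · N(y)` with the local unit `y = x₀ ∕ (a₂ x₁)` — `exists_unit_norm_kernelLineCM`, in the binder shape of ★ (LM)
`F0P2oLineWeilCMLineMatching.exists_intertwiner_lineWeilCM_of_eq_mul_norm`'s `hty` (`t := fun _ => dV′ 0`, `d := kernelLineCM dV′`).

USE ((C5c) of the (N′)-at-the-block-frame brick): the block computation delivers GR's `ω¹` for the FRAME line `⟨dV′ 0⟩`; the letter wants it for the kernel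
line `kernelLineCM dV′`; ★ (LM) matches the two line Weil representations on the nose given exactly this `y`.
[Jacobowitz1962, Thm. 3.1 (a hyperbolic plane has discriminant `−1` modulo norms); GelbartRogawski1991, §3.2 (3.2.1) p. 457.]

## References
* [Jacobowitz1962] R. Jacobowitz, *Hermitian forms over local fields*, Amer. J. Math. 84 (1962): Thm. 3.1.
* [GelbartRogawski1991] S. Gelbart, J. Rogawski, Invent. Math. 105 (1991): §3.2 (3.2.1) p. 457.
-/

set_option autoImplicit false
set_option linter.dupNamespace false -- the mandated namespace repeats the single-problem summit's segment

noncomputable section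

open scoped Matrix
open _root_.Matrix NumberField IsDedekindDomain
open Literature.NumberTheory.Automorphic Literature.NumberTheory.Automorphic.UnitaryGroup
open Literature.NumberTheory.GelbartRogawski1991

namespace Summit.HodgeConjecture.HodgeConjecture.Cruxes.H413.F0P2oKernelLineNormUnit

variable (L : Type) [Field L] [NumberField L] [IsCMField L]

set_option maxHeartbeats 1600000 in
/-- **(KL) THE KERNEL LINE IS THE FRAME LINE TIMES A LOCAL NORM.**  At a finite place `v` of `L⁺` non-split in `L`, for a real non-zero diagonal
`dV′ : Fin 3 → L` and an isotropic vector `x ≠ 0` of the plane `diag(dV′ 1, dV′ 2) ⊗ 1` over `S = L ⊗ L⁺_v` (binders of ★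
`F0P2oBlockAdaptedCongruence.exists_hyperbolic_partner_of_nonsplit` at `a := dV′ ∘ succ`), there is a unit `y ∈ Sˣ` with
`ι(dV′ 0) = ι(kernelLineCM dV′ 0) · (y · σ y)` — the hypothesis `hty` of ★ (LM) `exists_intertwiner_lineWeilCM_of_eq_mul_norm` for
`t := fun _ => dV′ 0`, `d := kernelLineCM dV′`.  Proof: `σ(x₀) a₁ x₀ = −σ(x₁) a₂ x₁` in the field `S = L_w` forces `x₀, x₁ ≠ 0` and
`y := x₀ ∕ (a₂ x₁)` has `N(y) = −1∕(a₁a₂)`. [cite: Jacobowitz1962, Thm. 3.1] [cite: GelbartRogawski1991, §3.2 (3.2.1) p. 457] -/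
theorem exists_unit_norm_kernelLineCM (v : HeightOneSpectrum (𝓞 ↥(maximalRealSubfield L)))
    (hv : ∀ w : PlacesOver L v, IsCMField.complexConj L • w.1 = w.1)
    (dV' : Fin 3 → L) (hdV' : ∀ i, IsCMField.complexConj L (dV' i) = dV' i) (hdV'0 : ∀ i, dV' i ≠ 0)
    (x : Fin 2 → UnitaryGroup.LocalRing L v) (hx0 : x ≠ 0)
    (hxx : hermForm (conjLocal L (IsCMField.complexConj L) v)
      ((Matrix.diagonal fun k : Fin 2 => dV' k.succ).map (algebraMap L (UnitaryGroup.LocalRing L v))) x x = 0) :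
    ∃ y : (UnitaryGroup.LocalRing L v)ˣ,
      algebraMap L (UnitaryGroup.LocalRing L v) (dV' 0) =
        algebraMap L (UnitaryGroup.LocalRing L v) (kernelLineCM dV' 0) *
          ((y : UnitaryGroup.LocalRing L v) * conjLocal L (IsCMField.complexConj L) v y) := by
  classical
  set σ := conjLocal L (IsCMField.complexConj L) v with hσdef
  set ι := algebraMap L (UnitaryGroup.LocalRing L v) with hιdef
  have hσι : ∀ e : L, σ (ι e) = ι (IsCMField.complexConj L e) := fun e => conjLocal_algebraMap (IsCMField.complexConj L) v e
  -- at a non-split place an element of `S = L ⊗ L⁺_v` is read at the unique `w ∣ v`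
  obtain ⟨w⟩ := PlacesOver.nonempty L v
  have heq : ∀ u u' : UnitaryGroup.LocalRing L v, u = u' ↔ u w = u' w :=
    fun u u' => LocalRing.eq_iff_apply_eq (IsCMField.complexConj L) (IsCMField.complexConj_ne_one L) w (hv w) u u'
  have hne : ∀ u : UnitaryGroup.LocalRing L v, u ≠ 0 ↔ u w ≠ 0 := fun u => (heq u 0).not
  -- the isotropy relation, expanded
  have hrel : σ (x 0) * (ι (dV' 1) * x 0) + σ (x 1) * (ι (dV' 2) * x 1) = 0 := by
    have h := hxx
    simp only [Matrix.diagonal_map (map_zero ι), hermForm_apply, dotProduct, Fin.sum_univ_two, Matrix.mulVec_diagonal,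
      Function.comp_apply, Fin.succ_zero_eq_one, Fin.succ_one_eq_two] at h
    exact h
  -- realness and non-vanishing of the entries
  have hB : σ (ι (dV' 2)) = ι (dV' 2) := by rw [hσι, hdV' 2]
  have hι0 : ∀ i, ι (dV' i) w ≠ 0 := fun i => (hne _).1 ((map_ne_zero_iff ι (algebraMap L (UnitaryGroup.LocalRing L v)).injective).2 (hdV'0 i))
  have hσ0 : ∀ u : UnitaryGroup.LocalRing L v, u w ≠ 0 → σ u w ≠ 0 := fun u hu h0 =>
    hu (by
      have h1 : σ (σ u) = u := conjLocal_conjLocal_cm L v u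
      rw [← h1]
      have h2 : σ u = 0 := (heq _ _).2 (by rw [h0]; rfl)
      rw [h2, map_zero]; rfl)
  -- the relation at `w`
  have hrelw : σ (x 0) w * (ι (dV' 1) w * x 0 w) + σ (x 1) w * (ι (dV' 2) w * x 1 w) = 0 := by
    have h := congrArg (fun u : UnitaryGroup.LocalRing L v => u w) hrel
    simpa only [Pi.add_apply, Pi.mul_apply, Pi.zero_apply] using h
  -- both coordinates of `x` are non-zero
  have hx01 : x 0 w ≠ 0 ∧ x 1 w ≠ 0 := by
    by_contra hcon
    rw [not_and_or, not_not, not_not] at hcon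
    have key : x 0 w = 0 ∧ x 1 w = 0 := by
      rcases hcon with h0 | h1
      · refine ⟨h0, ?_⟩
        rw [h0, mul_zero, mul_zero, zero_add] at hrelw
        rcases mul_eq_zero.1 hrelw with h | h
        · by_contra h1; exact hσ0 _ h1 h
        · rcases mul_eq_zero.1 h with h | h
          · exact absurd h (hι0 2)
          · exact h
      · refine ⟨?_, h1⟩
        rw [h1, mul_zero, mul_zero, add_zero] at hrelw
        rcases mul_eq_zero.1 hrelw with h | h
        · by_contra h0; exact hσ0 _ h0 h
        · rcases mul_eq_zero.1 h with h | h
          · exact absurd h (hι0 1)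
          · exact h
    have hX0 : x 0 = 0 := (heq _ _).2 (by rw [key.1]; rfl)
    have hX1 : x 1 = 0 := (heq _ _).2 (by rw [key.2]; rfl)
    apply hx0
    funext k
    fin_cases k
    · exact hX0
    · exact hX1
  have hx0w : x 0 w ≠ 0 := hx01.1
  have hx1w : x 1 w ≠ 0 := hx01.2
  have hι1 : ι (dV' 1) w ≠ 0 := hι0 1
  have hι2 : ι (dV' 2) w ≠ 0 := hι0 2
  have hσx0 : σ (x 0) w ≠ 0 := hσ0 _ hx0w
  have hσx1 : σ (x 1) w ≠ 0 := hσ0 _ hx1w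
  -- the unit `y = x₀ ∕ (a₂ x₁)` (pointwise inverse at the unique `w`)
  have hq0 : ι (dV' 2) w * x 1 w ≠ 0 := mul_ne_zero hι2 hx1w
  refine ⟨⟨x 0 * (ι (dV' 2) * x 1)⁻¹, (ι (dV' 2) * x 1) * (x 0)⁻¹, (heq _ _).2 ?_, (heq _ _).2 ?_⟩, (heq _ _).2 ?_⟩
  · simp only [Pi.mul_apply, Pi.inv_apply, Pi.one_apply]
    field_simp
  · simp only [Pi.mul_apply, Pi.inv_apply, Pi.one_apply]
    field_simp
  · -- `σ` of the pointwise inverse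
    have hσinv : σ (ι (dV' 2) * x 1)⁻¹ w = (σ (ι (dV' 2) * x 1) w)⁻¹ := by
      have h1 : (ι (dV' 2) * x 1)⁻¹ * (ι (dV' 2) * x 1) = 1 :=
        (heq _ _).2 (by rw [Pi.mul_apply, Pi.inv_apply, Pi.one_apply, Pi.mul_apply]; exact inv_mul_cancel₀ hq0)
      have h2 := congrArg (fun u : UnitaryGroup.LocalRing L v => u w) (show σ (ι (dV' 2) * x 1)⁻¹ * σ (ι (dV' 2) * x 1) = 1 by
        rw [← map_mul, h1, map_one])
      simp only [Pi.mul_apply, Pi.one_apply] at h2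
      exact eq_inv_of_mul_eq_one_left h2
    have hσq : σ (ι (dV' 2) * x 1) w = ι (dV' 2) w * σ (x 1) w := by rw [map_mul, hB, Pi.mul_apply]
    have hk : ι (kernelLineCM dV' 0) = -(ι (dV' 0) * ι (dV' 1) * ι (dV' 2)) := by
      show ι (-(dV' 0 * dV' 1 * dV' 2)) = _
      rw [map_neg, map_mul, map_mul]
    rw [hk, Units.val_mk, map_mul σ, Pi.mul_apply, Pi.mul_apply, Pi.mul_apply, Pi.mul_apply, Pi.neg_apply, Pi.mul_apply, Pi.mul_apply,
      Pi.inv_apply, Pi.mul_apply, hσinv, hσq]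
    field_simp
    linear_combination (ι (dV' 0) w) * hrelw

end Summit.HodgeConjecture.HodgeConjecture.Cruxes.H413.F0P2oKernelLineNormUnit

end
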